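import Literature.AlgebraicGeometry.HodgeTheory.MotivatedClassesAlgebraic
import Literature.AlgebraicGeometry.HodgeTheory.MotivatedClassesPointAuxiliary
import Literature.AlgebraicGeometry.HodgeTheory.MotivatedClassesAssembly
import Literature.AlgebraicGeometry.HodgeTheory.HardLefschetzNFoldHolds
import Literature.AlgebraicGeometry.HodgeTheory.TopDegreeClasses
import HarnessLib

/-!
# Route HeckePrymWeil — crux `SummitOffWeilSector` (stmt-HodgeConjecture-14374), line
`motivated-anchor-split`, stub `stub_motivatedPullbackFst`: the unconditional instances of
André's Prop. 2.1 (ii), first inclusion, on the real carriers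

The stub `stub_motivatedPullbackFst` of the line is Y. André, *Pour une théorie inconditionnelle des
motifs*, Publ. Math. IHÉS 83 (1996), Prop. 2.1 (ii), FIRST inclusion (p. 14: "On a :
`pr^{XZ*}_X A_mot(X)_E ⊆ (A_mot(X × Z)_E)`"), on the real carriers of the summit statement: for `X`,
`Z` smooth projective over `ℂ` of dimensions `n`, `l` and `x ∈ A_motᵖ(X)_ℂ = motivatedClasses n X p`,
`pr_X^* x = complexBetti.map (fst X Z) (2p) x ∈ A_motᵖ(X ⊗ Z)_ℂ`. In print (p. 15: "on conclut en
appliquant le lemme 1.3.2") it rests on Lemme 1.3.2 — the Lefschetz involution of the PRODUCT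
polarisation `η ⊠ 1 + 1 ⊠ η_Z` on exterior products, through Künneth and the Lefschetz
decomposition — which the tree has over an abstract Weil cohomology
(`Motives/LefschetzStarExternalProduct`) but not on the real carriers `H•(X(ℂ); ℂ)`.

This file records the part of the inclusion that holds on the real carriers WITHOUT Lemme 1.3.2,
i.e. the classes `x` that are already ALGEBRAIC (`x ∈ Nᵖ H²ᵖ(X(ℂ); ℂ) = algebraicClasses X p`):

* `motivatedPullbackFst_of_mem_algebraicClasses` — **`pr_X^*(A(X)) ⊆ A_mot(X ⊗ Z)`**: flat
  pull-back preserves the coniveau (`map_fst_mem_supportedClasses`, Hartshorne III Prop. 9.5), and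
  `A(X ⊗ Z) ⊆ A_mot(X ⊗ Z)` ("il est clair", André §2.1 p. 14; the tree's
  `algebraicClasses_le_motivatedClasses_of_nonempty_hardLefschetzNFold_self`, the polarisation of
  `X ⊗ Z` being supplied by the PROVED hard Lefschetz theorem `nonempty_hardLefschetzNFold_holds`,
  Voisin I Thm. 6.25) — registered as a sub-goal stub of the line;
* `motivatedPullbackFst_of_motivatedClasses_le` — hence the stub at every `(X, p)` with
  `A_motᵖ(X)_ℂ ⊆ Nᵖ H²ᵖ`, and its unconditional cases: `p = 0` (`N⁰ H⁰ = H⁰`,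
  `motivatedPullbackFst_zero`), `p ≥ n = dim X` (`H²ⁿ = Nⁿ H²ⁿ`, the class of a point,
  `mem_algebraicClasses_of_degree_top`; `H²ᵖ = 0` for `p > n`; `motivatedPullbackFst_of_dim_le`),
  so that the stub holds outright for `dim X ≤ 1` (`stub_motivatedPullbackFst_of_dim_le_one`);
* `motivatedPullbackFst_of_standardConjectureB_of_cupProduct` — the stub GRANTED the two OTHER
  conjectural inputs of the line, the standard conjecture `B(Z)` for every smooth projective `Z`
  (the antecedent of the tree's named fact
  `Andre1996_motivatedClasses_le_algebraicClasses_of_standardConjectureB`, André §2.1 remark: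
  `B ⇒ A_mot = A`) and the multiplicativity of algebraic classes
  (`Voisin2003_cupProduct_algebraicClasses`, Voisin II Prop. 9.20): then `A_mot(X) = A(X)`
  (`Andre1996_motivatedClasses_le_algebraicClasses_of_standardConjectureB_holds_of`) and the first
  bullet applies. (Within the line, the stub is thus subsumed by `stub_lefschetzStandardB` and
  `stub_cupProductAlgebraic`; unconditionally it is André's Lemme 1.3.2 on the real carriers.)

No definition and no named fact is introduced.

## References

* [Andre1996Motifs] Y. André, Pour une théorie inconditionnelle des motifs, Publ. Math. IHÉS 83
  (1996) 5–49: §2.1 Déf. 1, remark and Prop. 2.1 (p. 14), proof (p. 15), Lemme 1.3.2 (p. 13).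
* [Hartshorne1977] R. Hartshorne, Algebraic Geometry, GTM 52, III Prop. 9.5.
* [VoisinHodgeI2002] C. Voisin, Hodge Theory and Complex Algebraic Geometry I, CUP 2002, Thm. 6.25,
  Rem. 6.27, §11.3.
* [VoisinHodgeII2003] C. Voisin, Hodge Theory and Complex Algebraic Geometry II, CUP 2003, §9.2.4
  Prop. 9.20, §10.2.3 proof of Prop. 10.26.
-/

noncomputable section

-- every declaration of this problem lives in `Summit.HodgeConjecture.HodgeConjecture.…` (summit = sub-problem)
set_option linter.dupNamespace false

open CategoryTheory AlgebraicGeometry MonoidalCategory CartesianMonoidalCategory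
open Literature.AlgebraicTopology.SingularHomology Literature.Geometry.Kaehler
open Literature.AlgebraicGeometry Literature.AlgebraicGeometry.Motives
  Literature.AlgebraicGeometry.HodgeTheory

namespace Summit.HodgeConjecture.HodgeConjecture.Theorems

/-- **`pr_X^*(A(X)) ⊆ A_mot(X ⊗ Z)`** — André's Prop. 2.1 (ii), first inclusion
("`pr^{XZ*}_X A_mot(X)_E ⊆ A_mot(X × Z)_E`"), for the ALGEBRAIC classes `A(X) ⊆ A_mot(X)`, on the
real carriers and unconditionally: for `X`, `Z` smooth projective over `ℂ` of dimensions `n`, `l`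
and `x ∈ Nᵖ H²ᵖ(X(ℂ); ℂ) = algebraicClasses X p`, the pull-back `pr_X^* x ∈ H²ᵖ((X ⊗ Z)(ℂ); ℂ)`
lies in `A_motᵖ(X ⊗ Z)_ℂ = motivatedClasses (n + l) (X ⊗ Z) p`. Proof: `pr_X` is flat, so `pr_X^*`
preserves the coniveau (`map_fst_mem_supportedClasses`, Hartshorne III Prop. 9.5:
`pr_X^* x ∈ Nᵖ H²ᵖ((X ⊗ Z)(ℂ))`), and algebraic classes of the smooth projective `(n + l)`-fold
`X ⊗ Z` are motivated ("il est clair que `A_mot(X)_E` contient `A(X)`", André §2.1 p. 14; the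
tree's `algebraicClasses_le_motivatedClasses_of_nonempty_hardLefschetzNFold_self`), the
polarisation class of `X ⊗ Z` that Déf. 1 requires being the hyperplane class of the hard
Lefschetz theorem (`nonempty_hardLefschetzNFold_holds`, Voisin I Thm. 6.25 — proved in the tree).
[cite: Andre1996Motifs, Prop. 2.1 (ii) and the remark following Déf. 1 (p. 14)]
[cite: Hartshorne1977, III Prop. 9.5] [cite: VoisinHodgeI2002, Thm. 6.25 and Rem. 6.27] -/
theorem motivatedPullbackFst_of_mem_algebraicClasses :
    ∀ ⦃n l : ℕ⦄ ⦃X Z : SchemeOver ℂ⦄, IsSmoothProjective n X → IsSmoothProjective l Z →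
      ∀ (p : ℕ), ∀ x ∈ algebraicClasses X p,
        complexBetti.map (fst X Z) (2 * p) x ∈ motivatedClasses (n + l) (X ⊗ Z) p := by
  intro n l X Z hX hZ p x hx
  have hXZ : IsSmoothProjective (n + l) (X ⊗ Z) := IsSmoothProjective.tensor_holds hX hZ
  have hx' : complexBetti.map (fst X Z) (2 * p) x ∈ algebraicClasses (X ⊗ Z) p :=
    map_fst_mem_supportedClasses hX hZ hx
  exact algebraicClasses_le_motivatedClasses_of_nonempty_hardLefschetzNFold_self hXZ
    (nonempty_hardLefschetzNFold_holds (n + l) (X ⊗ Z)) p hx'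

/-- **The stub at every `(X, p)` where motivated classes are algebraic**: if
`A_motᵖ(X)_ℂ ⊆ Nᵖ H²ᵖ(X(ℂ); ℂ)` (the conclusion of André's remark "`A_mot(X) = A(X)` si … `*_L` est
donnée par une correspondance algébrique", §2.1 p. 14, at `(X, p)`), then `pr_X^* x ∈ A_motᵖ(X ⊗ Z)_ℂ`
for every `x ∈ A_motᵖ(X)_ℂ` and every smooth projective `Z`
(`motivatedPullbackFst_of_mem_algebraicClasses`).
[cite: Andre1996Motifs, Prop. 2.1 (ii) and the remark following Déf. 1 (p. 14)] -/
theorem motivatedPullbackFst_of_motivatedClasses_le {n l : ℕ} {X Z : SchemeOver ℂ}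
    (hX : IsSmoothProjective n X) (hZ : IsSmoothProjective l Z) {p : ℕ}
    (hle : motivatedClasses n X p ≤ algebraicClasses X p) :
    ∀ x ∈ motivatedClasses n X p,
      complexBetti.map (fst X Z) (2 * p) x ∈ motivatedClasses (n + l) (X ⊗ Z) p :=
  fun x hx ↦ motivatedPullbackFst_of_mem_algebraicClasses hX hZ p x (hle hx)

/-- **The stub in codimension `0`**: `A_mot⁰(X)_ℂ ⊆ H⁰(X(ℂ); ℂ) = N⁰ H⁰` (`algebraicClasses_zero`:
every class of degree `0` is algebraic, the codimension-`0` case of the Hodge conjecture), so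
`pr_X^*(A_mot⁰(X)) ⊆ A_mot⁰(X ⊗ Z)` unconditionally. [cite: Andre1996Motifs, Prop. 2.1 (ii) (p. 14)]
[cite: VoisinHodgeI2002, §11.3] -/
theorem motivatedPullbackFst_zero {n l : ℕ} {X Z : SchemeOver ℂ} (hX : IsSmoothProjective n X)
    (hZ : IsSmoothProjective l Z) :
    ∀ x ∈ motivatedClasses n X 0,
      complexBetti.map (fst X Z) (2 * 0) x ∈ motivatedClasses (n + l) (X ⊗ Z) 0 :=
  motivatedPullbackFst_of_motivatedClasses_le hX hZ fun x _ ↦ by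
    rw [algebraicClasses_zero]
    exact Submodule.mem_top

/-- **The stub in codimension `p ≥ dim X`**: for `p = n ≥ 1` every class of `H²ⁿ(X(ℂ); ℂ)` is
algebraic (the class of a point, `mem_algebraicClasses_of_degree_top`, Voisin II proof of
Prop. 10.26), for `p = n = 0` this is the codimension-`0` case, and for `p > n`
`H²ᵖ(X(ℂ); ℂ) = 0` (`subsingleton_complexBetti`); in all three cases
`pr_X^*(A_motᵖ(X)) ⊆ A_motᵖ(X ⊗ Z)` unconditionally. [cite: Andre1996Motifs, Prop. 2.1 (ii) (p. 14)]
[cite: VoisinHodgeII2003, §10.2.3 proof of Prop. 10.26] -/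
theorem motivatedPullbackFst_of_dim_le {n l : ℕ} {X Z : SchemeOver ℂ} (hX : IsSmoothProjective n X)
    (hZ : IsSmoothProjective l Z) {p : ℕ} (hp : n ≤ p) :
    ∀ x ∈ motivatedClasses n X p,
      complexBetti.map (fst X Z) (2 * p) x ∈ motivatedClasses (n + l) (X ⊗ Z) p := by
  refine motivatedPullbackFst_of_motivatedClasses_le hX hZ fun x _ ↦ ?_
  rcases hp.lt_or_eq with hlt | rfl
  · -- `p > n`: `H²ᵖ(X(ℂ); ℂ) = 0`
    haveI := subsingleton_complexBetti hX (show 2 * n < 2 * p by omega)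
    rw [Subsingleton.elim x 0]
    exact Submodule.zero_mem _
  · rcases Nat.eq_zero_or_pos n with rfl | hn
    · rw [algebraicClasses_zero]
      exact Submodule.mem_top
    · exact mem_algebraicClasses_of_degree_top hX hn x

/-- **The stub for `dim X ≤ 1`** (points and curves), unconditionally: every codimension `p` is
`0` or `≥ dim X` (`motivatedPullbackFst_zero`, `motivatedPullbackFst_of_dim_le`).
[cite: Andre1996Motifs, Prop. 2.1 (ii) (p. 14)] -/
theorem stub_motivatedPullbackFst_of_dim_le_one :
    ∀ ⦃n l : ℕ⦄ ⦃X Z : SchemeOver ℂ⦄, n ≤ 1 → IsSmoothProjective n X → IsSmoothProjective l Z →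
      ∀ (p : ℕ), ∀ x ∈ motivatedClasses n X p,
        complexBetti.map (fst X Z) (2 * p) x ∈ motivatedClasses (n + l) (X ⊗ Z) p := by
  intro n l X Z hn hX hZ p
  rcases Nat.eq_zero_or_pos p with rfl | hp
  · exact motivatedPullbackFst_zero hX hZ
  · exact motivatedPullbackFst_of_dim_le hX hZ (by omega)

/-- **The stub granted `B` and the multiplicativity of algebraic classes** — the two OTHER
conjectural inputs of the line (`stub_lefschetzStandardB`, `stub_cupProductAlgebraic`), taken here
as explicit hypotheses: GRANTED the standard conjecture of Lefschetz type `B(Z)` in André's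
`*_L`-form for every smooth projective complex `Z` and every polarisation class (`hB`, the
antecedent of the tree's named fact `Andre1996_motivatedClasses_le_algebraicClasses_of_standardConjectureB`;
André §2.1 remark, p. 14: "`A_mot(X) = A(X)` si pour tout schéma `Y` dans `𝒱`, polarisé,
l'involution de Lefschetz est donnée par une correspondance algébrique") and the multiplicativity
`Nᵃ ∪ Nᵇ ⊆ Nᵃ⁺ᵇ` of algebraic classes (`hV = Voisin2003_cupProduct_algebraicClasses`, Voisin II
Prop. 9.20), motivated classes are algebraic
(`Andre1996_motivatedClasses_le_algebraicClasses_of_standardConjectureB_holds_of`), so Prop. 2.1 (ii),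
first inclusion, reduces to its algebraic case (`motivatedPullbackFst_of_mem_algebraicClasses`).
[cite: Andre1996Motifs, §2.1 remark following Déf. 1 and Prop. 2.1 (ii) (p. 14)]
[cite: VoisinHodgeII2003, §9.2.4 Prop. 9.20] -/
theorem motivatedPullbackFst_of_standardConjectureB_of_cupProduct
    (hV : Voisin2003_cupProduct_algebraicClasses)
    (hB : ∀ (d : ℕ) (Z : SchemeOver ℂ) (η : complexBetti Z 2), IsSmoothProjective d Z →
      StandardConjectureBStar d Z η) :
    ∀ ⦃n l : ℕ⦄ ⦃X Z : SchemeOver ℂ⦄, IsSmoothProjective n X → IsSmoothProjective l Z →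
      ∀ (p : ℕ), ∀ x ∈ motivatedClasses n X p,
        complexBetti.map (fst X Z) (2 * p) x ∈ motivatedClasses (n + l) (X ⊗ Z) p :=
  fun _ _ _ _ hX hZ p ↦ motivatedPullbackFst_of_motivatedClasses_le hX hZ
    (Andre1996_motivatedClasses_le_algebraicClasses_of_standardConjectureB_holds_of hV hB hX p)

end Summit.HodgeConjecture.HodgeConjecture.Theorems

end
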